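import Summits.QuantumFields.YangMills.Theorems.BalabanUVNodesN12AtRecord13TermPinnedZres
import Summits.QuantumFields.YangMills.Theorems.BalabanUVNodesN12AtTheta13OfThm1CCMWSmallWindow

/-!
# BalabanUVNodes ∕ N12 — N12's MOST-PINNED ROW IN NODE O's (2.7)-SMALL WINDOW: 12I's small-window `Λ`-row at dag-n12-e's `Z″`∕side∕`χ(Ω^{∼4})`∕`Ω″`-pinned situation stack `σᶻ`
# (generic `Θ`), and at the window-edition witness `θ₁₅ᶜᶜᴹ(jM;γ) = theta13OfThm1CCMW F N jM γ ε₀ ε₂₉ B₃ B₃' a₀ a₁` with the β letters from stub 3ʷ's box and NODE O's smallness on the explicit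
# window `γ ≤ e⁻³`, `γ²β′ ≤ 1` — THE SHORTEST LOCATED-INPUT LIST OF N12 (Track A, DAG node N12 = [B15, Balaban1989LargeFieldI] CMP **122** (1989) 175–202; cluster K1 — K1⁷
# `StabilityBAtRecordR13SepCoPH` = stmt-QuantumFields-20542, helper; seat `pub-ymgap-dag-n12-d` g14 (R134 s2 «knit at the record»), 2026-08-27; count-neutral, CONDITIONAL, NOT a discharge)

HONEST FRAMING.  Count-neutral kernel BOOKKEEPING BY NAME, the `_of_inInterval` twin of 12P `…N12AtRecord13TermPinnedZres` §1: 12I §1 ★★ `b15Leaf_WOfRecord₁₃_pinAllΛ_N0_liveRepin₁₃_of_massLive_of_hasResiduals_of_inInterval`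
(this seat g8; the (2.7)-small-window form of the `Λ`-pinned leaf, dag-n12-e module 16 §7 `h189_pinD189ΛH₁₃_of_h180_of_inInterval`) INSTANTIATED at dag-n12-e's fully pinned situation family
`σᶻ P := ((((σ P).pinZres …).pinSides …).pinXΩ4 …).pinOmegaPP …)` (modules 17–19; `0 < sh` from `0 < M₂` by module 17's `cubeSide_pos`, exactly as 12P did for the `_of_flow` row) — §1, generic `Θ`
with K0b's residuals; and §2 at dag-n21-c's window edition (A1ʷ∕A2ʷ) with: `β ≥ 0` along the history ⟸ stub 3ʷ's lower box (A2ʷ `betaLowerH_theta13OfThm1CCMW_of_half` ∘ dag-n12-e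
`betaAlongHistory_nonneg_of_betaLowerH` on the run's window), the (2.7) bound ⟸ stub 3ʷ's upper box (A2ʷ `betaUpperH_theta13OfThm1CCMW_of_half`), NODE O's `SmallnessFor γ β′ ½ 2 1` ⟸ the explicit
window `γ ≤ e⁻³`, `γ²β′ ≤ 1` (12Iᵂ `smallnessFor_half_two_one`), `γ·A₀·log γ⁻² ≤ 1∕10` (12Iᵂ §0 + K0a `A0OfThm1CC1_le` ∕ `A0OfThm1C_le_sixteenth`), `r = p₀ = M₂ = 1`, `M = L^{jM}`, `θ.γ = γ` (`rfl`).
WHAT IT SHOWS: N12's most-pinned row (every region letter of the (1.89) situation except the component union `Z` an object of record) at the V16 witness reads per run ONLY: live-mass (NODE 00),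
Prop. 1 at `λ.LF P` (dag-n12-c ∕ 12Q⁵), the run's window `Step.InInterval γ (kSel P + 1) g` (inside the K1 world's `Step.InInterval w.γ P.K`, `w.γ ≤ γ`), the levels `N₀ ≤ N P`, `N₀ ≤ kSel P + 1`,
the base situation's residual NUMBERS (`0 ≤ β ≤ ¼`, `2 ≤ L₀`, `L₀² ≤ L`, `0 ≤ O(1)B₃B₅`, `0 ≤ δ`), print's two p. 200 conditions `hwin`∕`hMl` (reading `M = L^{jM}`), `Λ ≠ ∅`, the four ℍ-leaves + (1.80)
(N07); witness-side only stub 3ʷ's box, `0 < γ ≤ ½`, `γ ≤ e⁻³`, `γ²β′ ≤ 1` and the weak signs `0 ≤ B₃, B₃′, a₀, a₁`.  NO flow display (2.8a), NO coupling-step display, NO `ε`-range, NO `hN₀`, NO `hlog`,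
NO `SmallnessFor`.  Stub 3ʷ's box is NODE O's hypothesis (sign of β UNPRINTED, [II] p.355; N12 READS it through the coupling step); nothing of Bałaban's is asserted; N12 is NOT discharged; no node
is discharged; K0⁷ ∕ K1⁷ NOT closed; counts unmoved (discharged 5∕27 · Track A 5∕28).  ONE finite four-torus programme at fixed `ε = L^{-K}` — nothing continuum ∕ ℝ⁴ ∕ OS ∕ mass gap ∕ Clay.
No `sorry`, `def`, `instance`, `notation`.

Sources: [Balaban1989LargeFieldI] (0.2)–(0.6) p.176, (1.2) p.178, (1.10)–(1.11) p.179, (1.73) p.192, Prop. 1 (1.78) p.194, (1.80) p.195, (1.89) p.198, (1.91)–(1.102) pp.199–201;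
[Balaban1988Convergent] (2.1)–(2.9) pp.254–256, (2.17) p.257, (3.16)–(3.25) pp.268–270; [Balaban1987RG1] Thm 1 p.259, (0.20)–(0.21) p.256, §1 (1.20)–(1.22) p.264; [Balaban1989LargeFieldII] (1.4) p.357.
-/

noncomputable section

open MeasureTheory
open scoped Matrix.Norms.L2Operator

namespace Summit.QuantumFields.YangMills.BalabanUVNodes.N12AtRecord13TermPinnedZresWindow

open Literature.MathematicalPhysics.QuantumFieldTheory.Balaban1983to89
open Literature.MathematicalPhysics.QuantumFieldTheory.Balaban1983to89.T4Continuum (T4Family)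
open Literature.MathematicalPhysics.QuantumFieldTheory.Balaban1983to89.DagBinding (PrintedCarriers15 B15Leaf)
open Literature.MathematicalPhysics.QuantumFieldTheory.Balaban1983to89.Node00
open B15Claim189Assembly (Setting189 new189 chiPP dom half)
open B15 (Prop1Printed Ineq180)
open B15.BasicStep (Claim189)
open B15.PrelimIntegrations (Ineq191 Ineq195)
open B15Chi124DetSets (E124)
open B15DeterminingSets (MSField)
open B14DomainGeom (Pt)
open B8Eq17ClassAkV1 (plaqsOf)
open GaugeGroup (dist1)
open GaugeField (plaqHol)
open B15Claim189PrintedConditions (omegaOfChain)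
open B15Claim189PinsOfHistory (sitOfHist N0OfRecord₁₃ D189OfHist)
open B15Claim189LambdaPin (enlD)
open B15Claim189OmegaPPPin (cubeSide_pos)
open FlowStep (prefixOf BetaUpperH BetaLowerH)
open B14FlowStep (SmallnessFor)
open B15Claim189N0OfRecord (betaAlongHistory_nonneg_of_betaLowerH)
open Summit.QuantumFields.YangMills.BalabanUVNodes.N12AtRecord13TermPinnedLambda (b15Leaf_WOfRecord₁₃_pinAllΛ_N0_liveRepin₁₃_of_massLive_of_hasResiduals_of_inInterval)
open Summit.QuantumFields.YangMills.BalabanUVNodes.N12AtTheta13OfThm1CCMWSmallWindow (gamma_mul_p0Profile_le_tenth smallnessFor_half_two_one)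

variable {N : ℕ} [NeZero N] {F : T4Family}

/-! ## §1 GENERIC `Θ` CARRYING K0b's RESIDUALS — 12I's (2.7)-small-window `Λ`-row at the `Z″`-of-record ∕ side ∕ χ ∕ `Ω″`-pinned situation family -/

section Leaf
variable (Θ : Stage13Params F N) (lam : ResidW F N) (σ : ∀ P : B12.RunParams, Sit189 F N P.K)
  (s : ∀ P : B12.RunParams, SeqOfRecord F Θ.ν Θ.τ9.M (gOfRecord₁₃ F N (Θ.liveRepin₁₃ F N) P) P.K (lam.kSel P + 1)) (Nm : B12.RunParams → ℕ) (p₁ : ℕ)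

/-- **★★ THE (2.7)-SMALL-WINDOW `Λ`-ROW AT THE `Z″`-OF-RECORD ∕ SIDE ∕ `χ(Ω^{∼4})` ∕ `Ω″`-PINNED SITUATION FAMILY** (12I §1 ★★ `…_of_inInterval` at dag-n12-e's fully pinned stack
`σᶻ P := ((((σ P).pinZres Θ.ν Θ.τ9.M g (s P) (N₀ P)).pinSides Θ.ν g (k′ − N P) k′).pinXΩ4 (s P) enlD).pinOmegaPP (s P) (N P) enlD`, exactly as 12P §1 did for the window-free `_of_flow` row; `0 < sh` from `0 < M₂`
by module 17's `cubeSide_pos`): the flow inputs (2.8a), the coupling step, the `ε`-range, `2 ≤ N₀` and print's first p. 200 condition ALL from the run's window `]0, θL.γ]` up to `k′` + `β ≥ 0` along the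
history + `BetaUpperH β′ θL.γ` + `SmallnessFor θL.γ β′ β₀ L p₀`; the only residual REGION letter of the (1.89) situation is the component union `Z` (module 19).  Generic `Θ` carrying K0b's residuals;
contentful at a witness with a small window (`θ₁₅ᶜᶜᴹ(j;γ)`, §2).  CONDITIONAL; count-neutral. [cite: Balaban1989LargeFieldI, (0.2)–(0.6) p.176, (1.2) p.178, (1.10)–(1.11) p.179, (1.73) p.192, Prop. 1 (1.78) p.194, (1.80) p.195, (1.89) p.198, pp.199–201; Balaban1988Convergent, (2.1) p.254, (2.4)–(2.9) pp.255–256, (2.17) p.257, (3.16) p.268, (3.22)–(3.25) pp.269–270; Balaban1987RG1, (0.20) p.256, §1 p.264] -/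
theorem b15Leaf_WOfRecord₁₃_pinAllΛΩχZ_N0_liveRepin₁₃_of_massLive_of_hasResiduals_of_inInterval (hres : Θ.HasResidualsOfRecord F N)
    {P : B12.RunParams} (hK : lam.kSel P < P.K) (hM₂ : 0 < Θ.ν.M₂) (hM : 0 < Θ.τ9.M)
    {D : Setting189 (F.P P.K) (SU N) (MSField (F.P P.K) (SU N) × ((j : ℕ) → VecField (F.P P.K) j (EuclideanSpace ℝ (Fin (N ^ 2 - 1))))) (Pt (F.P P.K).d)}
    (hD : D = ((lam.pinRPrime₁₃ (Θ.liveRepin₁₃ F N)).pinD189ΛH (Θ.liveRepin₁₃ F N).ν (Θ.liveRepin₁₃ F N).A₁ (Θ.liveRepin₁₃ F N).τ9.M (gOfRecord₁₃ F N (Θ.liveRepin₁₃ F N)) (fun P => (((((σ P).pinZres Θ.ν Θ.τ9.M (gOfRecord₁₃ F N (Θ.liveRepin₁₃ F N) P) (s P) (N0OfRecord₁₃ (Θ.liveRepin₁₃ F N) P (lam.kSel P + 1))).pinSides Θ.ν (gOfRecord₁₃ F N (Θ.liveRepin₁₃ F N) P) (lam.kSel P + 1 - Nm P) (lam.kSel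 P + 1)).pinXΩ4 (s P) (enlD F Θ.ν Θ.τ9.M P (gOfRecord₁₃ F N (Θ.liveRepin₁₃ F N) P))).pinOmegaPP (s P) (Nm P) (enlD F Θ.ν Θ.τ9.M P (gOfRecord₁₃ F N (Θ.liveRepin₁₃ F N) P)))) s Nm p₁).D189 P)
    (hmassLive : ∀ a, LiveSeq F N Θ.ν Θ.τ9 P (gOfRecord₁₃ F N (Θ.liveRepin₁₃ F N) P) (lam.kSel P + 1)
        (slotsTOfRecord F N Θ.ν Θ.τ9 (EOfRecord₁₃ F N (Θ.liveRepin₁₃ F N)) (wOfRecord₉ F N (Θ.liveRepin₁₃ F N).toStage9Params)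
          (Θ.liveRepin₁₃ F N).ppSel P (gOfRecord₁₃ F N (Θ.liveRepin₁₃ F N) P) (lam.kSel P + 1)) a →
      0 < ∫ V, rterm (reprTOfRecord₁₃ F N (Θ.liveRepin₁₃ F N) P (lam.kSel P)) a V ∂(fieldMeasure (F.P P.K) (lam.kSel P + 1) (SU N)))
    (hP1 : Prop1Printed (lam.LF P))
    (hr : 1 ≤ Θ.ν.r) (hNN : (N0OfRecord₁₃ (Θ.liveRepin₁₃ F N) P (lam.kSel P + 1)) ≤ Nm P) (hNk : (N0OfRecord₁₃ (Θ.liveRepin₁₃ F N) P (lam.kSel P + 1)) ≤ lam.kSel P + 1)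
    (hβ0 : 0 ≤ (σ P).β) (hβ : (σ P).β ≤ 1 / 4) (hL₀ : 2 ≤ (σ P).L₀) (hL₀L : (σ P).L₀ ^ 2 ≤ ((F.P P.K).L : ℝ))
    (hB : 0 ≤ (σ P).O1 * (σ P).B₃ * (σ P).B₅) (hδ : 0 ≤ (σ P).δ)
    (hwin : 4 * (2 + (121 / 120) ^ 2 * ((σ P).O1 * (σ P).B₃ * (σ P).B₅ * (Θ.τ9.M : ℝ) ^ 5))
      ≤ ((Real.log ((gOfRecord₁₃ F N (Θ.liveRepin₁₃ F N) P) (lam.kSel P + 1) ^ 2)⁻¹) ^ Θ.ν.r) ^ (Real.log ((σ P).L₀ ^ 2) / Real.log ((F.P P.K).L : ℝ)))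
    (hβhist : ∀ j, j < lam.kSel P + 1 → 0 ≤ betaOfRecord₁₃ F N (Θ.liveRepin₁₃ F N) j (prefixOf (gOfRecord₁₃ F N (Θ.liveRepin₁₃ F N) P) j))
    (hMl : (121 / 120) ^ 2 * ((σ P).O1 * (σ P).B₃ * (σ P).B₅ * (Θ.τ9.M : ℝ) ^ 5) * Real.exp (-(4 * (σ P).δ * (Θ.τ9.M : ℝ))) ≤ 1 / 12)
    (hA₀ : 0 ≤ Θ.ν.A₀) {β' β₀ : ℝ} {L : ℕ} (S : SmallnessFor (Θ.liveRepin₁₃ F N).γ β' β₀ L Θ.ν.p₀) (hβ₀ : β₀ ≤ 1 / 2)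
    (hε10 : (Θ.liveRepin₁₃ F N).γ * p0Profile Θ.ν.A₀ Θ.ν.p₀ (Θ.liveRepin₁₃ F N).γ ≤ 1 / 10)
    (hI : Step.InInterval (Θ.liveRepin₁₃ F N).γ (lam.kSel P + 1) (gOfRecord₁₃ F N (Θ.liveRepin₁₃ F N) P)) (hup : BetaUpperH β' (Θ.liveRepin₁₃ F N).γ (betaOfRecord₁₃ F N (Θ.liveRepin₁₃ F N)))
    (hΛ : (((enlD F Θ.ν Θ.τ9.M P (gOfRecord₁₃ F N (Θ.liveRepin₁₃ F N) P)) 4 (lam.kSel P + 1 + 1 - (N0OfRecord₁₃ (Θ.liveRepin₁₃ F N) P (lam.kSel P + 1)))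
        (omegaOfChain (s P) (lam.kSel P + 1 + 1 - (N0OfRecord₁₃ (Θ.liveRepin₁₃ F N) P (lam.kSel P + 1)))))ᶜ ∩ (σ P).Z).Nonempty)
    (L91h : ∀ U, new189 D U → ∀ p ∈ plaqsOf (half D),
      Ineq191 (dist1 (plaqHol (D.Upp U) p)) (D.devV'' U p) D.α ((D.L ^ D.h)⁻¹) (D.ε D.h) (E124 D.ε D.L D.η D.k D.h))
    (L95 : ∀ U, new189 D U → ∀ p ∈ plaqsOf (half D),
      Ineq195 (D.devV'' U p) (dist1 (plaqHol (D.Uhalf U (D.boxOf p)) p)) D.α ((D.L ^ D.h)⁻¹) (D.ε D.h) (E124 D.ε D.L D.η D.k D.h))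
    (L91 : ∀ U, new189 D U → ∀ j, D.h ≤ j → j ≤ D.k → ∀ p ∈ plaqsOf (dom D j),
      Ineq191 (dist1 (plaqHol (D.Upp U) p)) (D.dev97 U p) D.α ((D.L ^ j)⁻¹) (D.ε j) (E124 D.ε D.L D.η D.k j))
    (L97 : ∀ U, new189 D U → ∀ j, D.h ≤ j → j ≤ D.k → ∀ p ∈ plaqsOf (dom D j),
      Ineq191 (D.dev97 U p) (D.dev0 U p) D.α ((D.L ^ j)⁻¹) (D.ε j) (E124 D.ε D.L D.η D.k j))
    (L80 : ∀ U, new189 D U → ∀ j, D.h ≤ j → j ≤ D.k → ∀ p ∈ plaqsOf (dom D j),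
      Ineq180 (D.dev0 U p) (D.ε D.k) D.η D.B₃ D.B₅ D.M D.δ (D.dist p) D.O1) :
    B15Leaf (WOfRecord₁₃ F N (Θ.liveRepin₁₃ F N)
      ((lam.pinRPrime₁₃ (Θ.liveRepin₁₃ F N)).pinD189ΛH (Θ.liveRepin₁₃ F N).ν (Θ.liveRepin₁₃ F N).A₁ (Θ.liveRepin₁₃ F N).τ9.M (gOfRecord₁₃ F N (Θ.liveRepin₁₃ F N))
        (fun P => (((((σ P).pinZres Θ.ν Θ.τ9.M (gOfRecord₁₃ F N (Θ.liveRepin₁₃ F N) P) (s P) (N0OfRecord₁₃ (Θ.liveRepin₁₃ F N) P (lam.kSel P + 1))).pinSides Θ.ν (gOfRecord₁₃ F N (Θ.liveRepin₁₃ F N) P) (lam.kSel P + 1 - Nm P) (lam.kSel P + 1)).pinXΩ4 (s P) (enlD F Θ.ν Θ.τ9.M P (gOfRecord₁₃ F N (Θ.liveRepin₁₃ F N) P))).pinOmegaPP (s P) (Nm P) (enlD F Θ.ν Θ.τ9.M P (gOfRecord₁₃ F N (Θ.liveRepin₁₃ F N) P)))) s Nm p₁) P) :=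
  -- `0 < sh` at the side-pinned stack: dag-n12-e module 17's `cubeSide_pos` from `0 < M₂`
  b15Leaf_WOfRecord₁₃_pinAllΛ_N0_liveRepin₁₃_of_massLive_of_hasResiduals_of_inInterval Θ lam
    (fun P => (((((σ P).pinZres Θ.ν Θ.τ9.M (gOfRecord₁₃ F N (Θ.liveRepin₁₃ F N) P) (s P) (N0OfRecord₁₃ (Θ.liveRepin₁₃ F N) P (lam.kSel P + 1))).pinSides Θ.ν (gOfRecord₁₃ F N (Θ.liveRepin₁₃ F N) P) (lam.kSel P + 1 - Nm P) (lam.kSel P + 1)).pinXΩ4 (s P) (enlD F Θ.ν Θ.τ9.M P (gOfRecord₁₃ F N (Θ.liveRepin₁₃ F N) P))).pinOmegaPP (s P) (Nm P) (enlD F Θ.ν Θ.τ9.M P (gOfRecord₁₃ F N (Θ.liveRepin₁₃ F N) P)))) s Nm p₁ hres hK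
    (cubeSide_pos (F.P P.K).L_pos hM₂ _ _ _) hM hD hmassLive hP1 hr hNN hNk hβ0 hβ hL₀ hL₀L hB hδ hwin hβhist hMl hA₀ S hβ₀ hε10 hI hup hΛ L91h L95 L91 L97 L80

end Leaf

/-! ## §2 AT THE WINDOW-EDITION WITNESS `θ₁₅ᶜᶜᴹ(jM;γ)` — stub 3ʷ's box, the explicit window, the weak signs -/

section Window
variable (jM : ℕ) (γ ε₀ ε₂₉ B₃ B₃' a₀ a₁ : ℝ) (lam : ResidW F N) (σ : ∀ P : B12.RunParams, Sit189 F N P.K)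
  (s : ∀ P : B12.RunParams, SeqOfRecord F (theta13OfThm1CCMW F N jM γ ε₀ ε₂₉ B₃ B₃' a₀ a₁).ν (theta13OfThm1CCMW F N jM γ ε₀ ε₂₉ B₃ B₃' a₀ a₁).τ9.M (gOfRecord₁₃ F N (theta13OfThm1CCMW F N jM γ ε₀ ε₂₉ B₃ B₃' a₀ a₁) P) P.K (lam.kSel P + 1)) (Nm : B12.RunParams → ℕ) (p₁ : ℕ)

/-- **★★★ THE SAME AT THE WINDOW-EDITION WITNESS `θ₁₅ᶜᶜᴹ(jM;γ)`, β LETTERS FROM STUB 3ʷ's BOX, NODE O's SMALLNESS ON THE EXPLICIT WINDOW** (§1 at `Θ := theta13OfNumerics …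
(stage12NumericsOfThm1CCMW F.L jM γ …) …`, K0b's residuals by K0a; `β ≥ 0` along the history ⟸ stub 3ʷ's lower box (A2ʷ transfer ∘ dag-n12-e `betaAlongHistory_nonneg_of_betaLowerH` on `hI`); the (2.7)
bound ⟸ stub 3ʷ's upper box; `SmallnessFor γ β′ ½ 2 1` ⟸ `γ ≤ e⁻³`, `γ²β′ ≤ 1` (12Iᵂ `smallnessFor_half_two_one`); `γ·A₀·log γ⁻² ≤ 1∕10` (12Iᵂ §0); `r = p₀ = M₂ = 1`, `M = L^{jM}`, `θ.γ = γ`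
by `rfl`): N12's MOST-PINNED ROW WITH ITS SHORTEST LOCATED LIST — per run: live-mass (NODE 00), Prop. 1 at `λ.LF P`, the run's window `hI` up to `kSel P + 1` (inside the K1 world's), the levels
`hNN`∕`hNk`, the base situation's residual numbers (`0 ≤ β ≤ ¼`, `2 ≤ L₀`, `L₀² ≤ L`, `0 ≤ O(1)B₃B₅`, `0 ≤ δ`), print's p. 200 conditions `hwin`∕`hMl`, `Λ ≠ ∅`, the four ℍ-leaves + (1.80) at `D`;
witness-side: `0 < γ ≤ ½`, `γ ≤ e⁻³`, `γ²β′ ≤ 1`, stub 3ʷ's box, the weak signs.  CONDITIONAL; count-neutral; NOT a discharge of N12. [cite: Balaban1989LargeFieldI, (0.2)–(0.6) p.176, (1.2) p.178, (1.10)–(1.11) p.179, (1.73) p.192, Prop. 1 (1.78) p.194, (1.80) p.195, (1.89) p.198, pp.199–201; Balaban1988Convergent, (2.1)–(2.9) pp.254–256, (2.17) p.257, (3.16)–(3.25) pp.268–270; Balaban1987RG1, Thm 1 p.259, (0.20)–(0.21) p.256, §1 (1.20)–(1.22) p.264; Balaban1989LargeFieldII, (1.4) p.357 (bookkeeping)]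 -/
theorem b15Leaf_WOfRecord₁₃_pinAllΛΩχZ_N0_theta13OfThm1CCMW_of_massLive_of_inInterval_of_betaBoxW_of_window
    -- the witness: NODE O's window `0 < γ ≤ ½`, made (2.7)-small EXPLICITLY (`γ ≤ e⁻³`, `γ²·β' ≤ 1` for stub 3ʷ's upper constant `β' ≥ 0`), and the weak signs of the [15]∕(2.8) letters
    (hγ0 : 0 < γ) (hγh : γ ≤ 1 / 2) {β' : ℝ} (hβ'0 : 0 ≤ β') (hγe : γ ≤ Real.exp (-3)) (hγβ : γ ^ 2 * β' ≤ 1) (hwB : 0 ≤ B₃) (hwB' : 0 ≤ B₃') (hwa₀ : 0 ≤ a₀) (hwa₁ : 0 ≤ a₁)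
    {P : B12.RunParams} (hK : lam.kSel P < P.K)
    {D : Setting189 (F.P P.K) (SU N) (MSField (F.P P.K) (SU N) × ((j : ℕ) → VecField (F.P P.K) j (EuclideanSpace ℝ (Fin (N ^ 2 - 1))))) (Pt (F.P P.K).d)}
    (hD : D = ((lam.pinRPrime₁₃ (theta13OfThm1CCMW F N jM γ ε₀ ε₂₉ B₃ B₃' a₀ a₁)).pinD189ΛH (theta13OfThm1CCMW F N jM γ ε₀ ε₂₉ B₃ B₃' a₀ a₁).ν (theta13OfThm1CCMW F N jM γ ε₀ ε₂₉ B₃ B₃' a₀ a₁).A₁ (theta13OfThm1CCMW F N jM γ ε₀ ε₂₉ B₃ B₃' a₀ a₁).τ9.M (gOfRecord₁₃ F N (theta13OfThm1CCMW F N jM γ ε₀ ε₂₉ B₃ B₃' a₀ a₁)) (fun P => (((((σ P).pinZres (theta13OfThm1CCMW F N jM γ ε₀ ε₂₉ B₃ B₃' a₀ a₁).ν (theta13OfThm1CCMW F N jM γ ε₀ ε₂₉ B₃ B₃' a₀ a₁).τ9.M (gOfRecord₁₃ F N (theta13OfThm1CCMW F N jM γ ε₀ ε₂₉ B₃ B₃'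 a₀ a₁) P) (s P) (N0OfRecord₁₃ (theta13OfThm1CCMW F N jM γ ε₀ ε₂₉ B₃ B₃' a₀ a₁) P (lam.kSel P + 1))).pinSides (theta13OfThm1CCMW F N jM γ ε₀ ε₂₉ B₃ B₃' a₀ a₁).ν (gOfRecord₁₃ F N (theta13OfThm1CCMW F N jM γ ε₀ ε₂₉ B₃ B₃' a₀ a₁) P) (lam.kSel P + 1 - Nm P) (lam.kSel P + 1)).pinXΩ4 (s P) (enlD F (theta13OfThm1CCMW F N jM γ ε₀ ε₂₉ B₃ B₃' a₀ a₁).ν (theta13OfThm1CCMW F N jM γ ε₀ ε₂₉ B₃ B₃' a₀ a₁).τ9.M P (gOfRecord₁₃ F N (theta13OfThm1CCMW F N jM γ ε₀ ε₂₉ B₃ B₃' a₀ a₁) P))).pinOmegaPP (s P) (Nm P) (enlD F (theta13OfThm1CCMW F N jM γ ε₀ ε₂₉ B₃ B₃' a₀ a₁).ν (theta13OfThm1CCMW F N jM γ ε₀ ε₂₉ B₃ B₃' a₀ a₁).τ9.M P (gOfRecord₁₃ F N (theta13OfThm1CCMW F N jM γ ε₀ ε₂₉ B₃ B₃' a₀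 a₁) P)))) s Nm p₁).D189 P)
    (hmassLive : ∀ a, LiveSeq F N (theta13OfThm1CCMW F N jM γ ε₀ ε₂₉ B₃ B₃' a₀ a₁).ν (theta13OfThm1CCMW F N jM γ ε₀ ε₂₉ B₃ B₃' a₀ a₁).τ9 P (gOfRecord₁₃ F N (theta13OfThm1CCMW F N jM γ ε₀ ε₂₉ B₃ B₃' a₀ a₁) P) (lam.kSel P + 1)
        (slotsTOfRecord F N (theta13OfThm1CCMW F N jM γ ε₀ ε₂₉ B₃ B₃' a₀ a₁).ν (theta13OfThm1CCMW F N jM γ ε₀ ε₂₉ B₃ B₃' a₀ a₁).τ9 (EOfRecord₁₃ F N (theta13OfThm1CCMW F N jM γ ε₀ ε₂₉ B₃ B₃' a₀ a₁)) (wOfRecord₉ F N (theta13OfThm1CCMW F N jM γ ε₀ ε₂₉ B₃ B₃' a₀ a₁).toStage9Params)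
          (theta13OfThm1CCMW F N jM γ ε₀ ε₂₉ B₃ B₃' a₀ a₁).ppSel P (gOfRecord₁₃ F N (theta13OfThm1CCMW F N jM γ ε₀ ε₂₉ B₃ B₃' a₀ a₁) P) (lam.kSel P + 1)) a →
      0 < ∫ V, rterm (reprTOfRecord₁₃ F N (theta13OfThm1CCMW F N jM γ ε₀ ε₂₉ B₃ B₃' a₀ a₁) P (lam.kSel P)) a V ∂(fieldMeasure (F.P P.K) (lam.kSel P + 1) (SU N)))
    (hP1 : Prop1Printed (lam.LF P))
    (hNN : (N0OfRecord₁₃ (theta13OfThm1CCMW F N jM γ ε₀ ε₂₉ B₃ B₃' a₀ a₁) P (lam.kSel P + 1)) ≤ Nm P) (hNk : (N0OfRecord₁₃ (theta13OfThm1CCMW F N jM γ ε₀ ε₂₉ B₃ B₃' a₀ a₁) P (lam.kSel P + 1)) ≤ lam.kSel P + 1)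
    (hβ0 : 0 ≤ (σ P).β) (hβ : (σ P).β ≤ 1 / 4) (hL₀ : 2 ≤ (σ P).L₀) (hL₀L : (σ P).L₀ ^ 2 ≤ ((F.P P.K).L : ℝ))
    (hB : 0 ≤ (σ P).O1 * (σ P).B₃ * (σ P).B₅) (hδ : 0 ≤ (σ P).δ)
    (hwin : 4 * (2 + (121 / 120) ^ 2 * ((σ P).O1 * (σ P).B₃ * (σ P).B₅ * ((theta13OfThm1CCMW F N jM γ ε₀ ε₂₉ B₃ B₃' a₀ a₁).τ9.M : ℝ) ^ 5))
      ≤ ((Real.log ((gOfRecord₁₃ F N (theta13OfThm1CCMW F N jM γ ε₀ ε₂₉ B₃ B₃' a₀ a₁) P) (lam.kSel P + 1) ^ 2)⁻¹) ^ (theta13OfThm1CCMW F N jM γ ε₀ ε₂₉ B₃ B₃' a₀ a₁).ν.r) ^ (Real.log ((σ P).L₀ ^ 2) / Real.log ((F.P P.K).L : ℝ)))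
    (hMl : (121 / 120) ^ 2 * ((σ P).O1 * (σ P).B₃ * (σ P).B₅ * ((theta13OfThm1CCMW F N jM γ ε₀ ε₂₉ B₃ B₃' a₀ a₁).τ9.M : ℝ) ^ 5) * Real.exp (-(4 * (σ P).δ * ((theta13OfThm1CCMW F N jM γ ε₀ ε₂₉ B₃ B₃' a₀ a₁).τ9.M : ℝ))) ≤ 1 / 12)
    (hI : Step.InInterval (theta13OfThm1CCMW F N jM γ ε₀ ε₂₉ B₃ B₃' a₀ a₁).γ (lam.kSel P + 1) (gOfRecord₁₃ F N (theta13OfThm1CCMW F N jM γ ε₀ ε₂₉ B₃ B₃' a₀ a₁) P)) 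
    -- stub 3ʷ's box at these letters: `0 ≤ b`, the γ-box of `betaOfRecord₁₃ F N θ₁₅ᶜᶜᴹ(jM)` (= the window edition's β on `]0,γ]`, A2ʷ) — feeds `β ≥ 0` along the history AND the (2.7) upper bound
    {b : ℝ} (hb : 0 ≤ b) (hβlo : BetaLowerH b γ (betaOfRecord₁₃ F N (theta13OfThm1CCM F N jM ε₀ ε₂₉ B₃ B₃' a₀ a₁))) (hβhi : BetaUpperH β' γ (betaOfRecord₁₃ F N (theta13OfThm1CCM F N jM ε₀ ε₂₉ B₃ B₃' a₀ a₁)))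
    (hΛ : (((enlD F (theta13OfThm1CCMW F N jM γ ε₀ ε₂₉ B₃ B₃' a₀ a₁).ν (theta13OfThm1CCMW F N jM γ ε₀ ε₂₉ B₃ B₃' a₀ a₁).τ9.M P (gOfRecord₁₃ F N (theta13OfThm1CCMW F N jM γ ε₀ ε₂₉ B₃ B₃' a₀ a₁) P)) 4 (lam.kSel P + 1 + 1 - (N0OfRecord₁₃ (theta13OfThm1CCMW F N jM γ ε₀ ε₂₉ B₃ B₃' a₀ a₁) P (lam.kSel P + 1)))
        (omegaOfChain (s P) (lam.kSel P + 1 + 1 - (N0OfRecord₁₃ (theta13OfThm1CCMW F N jM γ ε₀ ε₂₉ B₃ B₃' a₀ a₁) P (lam.kSel P + 1)))))ᶜ ∩ (σ P).Z).Nonempty)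
    (L91h : ∀ U, new189 D U → ∀ p ∈ plaqsOf (half D),
      Ineq191 (dist1 (plaqHol (D.Upp U) p)) (D.devV'' U p) D.α ((D.L ^ D.h)⁻¹) (D.ε D.h) (E124 D.ε D.L D.η D.k D.h))
    (L95 : ∀ U, new189 D U → ∀ p ∈ plaqsOf (half D),
      Ineq195 (D.devV'' U p) (dist1 (plaqHol (D.Uhalf U (D.boxOf p)) p)) D.α ((D.L ^ D.h)⁻¹) (D.ε D.h) (E124 D.ε D.L D.η D.k D.h))
    (L91 : ∀ U, new189 D U → ∀ j, D.h ≤ j → j ≤ D.k → ∀ p ∈ plaqsOf (dom D j),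
      Ineq191 (dist1 (plaqHol (D.Upp U) p)) (D.dev97 U p) D.α ((D.L ^ j)⁻¹) (D.ε j) (E124 D.ε D.L D.η D.k j))
    (L97 : ∀ U, new189 D U → ∀ j, D.h ≤ j → j ≤ D.k → ∀ p ∈ plaqsOf (dom D j),
      Ineq191 (D.dev97 U p) (D.dev0 U p) D.α ((D.L ^ j)⁻¹) (D.ε j) (E124 D.ε D.L D.η D.k j))
    (L80 : ∀ U, new189 D U → ∀ j, D.h ≤ j → j ≤ D.k → ∀ p ∈ plaqsOf (dom D j),
      Ineq180 (D.dev0 U p) (D.ε D.k) D.η D.B₃ D.B₅ D.M D.δ (D.dist p) D.O1) :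
    B15Leaf (WOfRecord₁₃ F N (theta13OfThm1CCMW F N jM γ ε₀ ε₂₉ B₃ B₃' a₀ a₁)
      ((lam.pinRPrime₁₃ (theta13OfThm1CCMW F N jM γ ε₀ ε₂₉ B₃ B₃' a₀ a₁)).pinD189ΛH (theta13OfThm1CCMW F N jM γ ε₀ ε₂₉ B₃ B₃' a₀ a₁).ν (theta13OfThm1CCMW F N jM γ ε₀ ε₂₉ B₃ B₃' a₀ a₁).A₁ (theta13OfThm1CCMW F N jM γ ε₀ ε₂₉ B₃ B₃' a₀ a₁).τ9.M (gOfRecord₁₃ F N (theta13OfThm1CCMW F N jM γ ε₀ ε₂₉ B₃ B₃' a₀ a₁))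
        (fun P => (((((σ P).pinZres (theta13OfThm1CCMW F N jM γ ε₀ ε₂₉ B₃ B₃' a₀ a₁).ν (theta13OfThm1CCMW F N jM γ ε₀ ε₂₉ B₃ B₃' a₀ a₁).τ9.M (gOfRecord₁₃ F N (theta13OfThm1CCMW F N jM γ ε₀ ε₂₉ B₃ B₃' a₀ a₁) P) (s P) (N0OfRecord₁₃ (theta13OfThm1CCMW F N jM γ ε₀ ε₂₉ B₃ B₃' a₀ a₁) P (lam.kSel P + 1))).pinSides (theta13OfThm1CCMW F N jM γ ε₀ ε₂₉ B₃ B₃' a₀ a₁).ν (gOfRecord₁₃ F N (theta13OfThm1CCMW F N jM γ ε₀ ε₂₉ B₃ B₃' a₀ a₁) P) (lam.kSel P + 1 - Nm P) (lam.kSel P + 1)).pinXΩ4 (s P) (enlD F (theta13OfThm1CCMW F N jM γ ε₀ ε₂₉ B₃ B₃' a₀ a₁).ν (theta13OfThm1CCMW F N jM γ ε₀ ε₂₉ B₃ B₃' a₀ a₁).τ9.M P (gOfRecord₁₃ F N (theta13OfThm1CCMW F N jM γ ε₀ ε₂₉ B₃ B₃' a₀ a₁) P))).pinOmegaPP (s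 P) (Nm P) (enlD F (theta13OfThm1CCMW F N jM γ ε₀ ε₂₉ B₃ B₃' a₀ a₁).ν (theta13OfThm1CCMW F N jM γ ε₀ ε₂₉ B₃ B₃' a₀ a₁).τ9.M P (gOfRecord₁₃ F N (theta13OfThm1CCMW F N jM γ ε₀ ε₂₉ B₃ B₃' a₀ a₁) P)))) s Nm p₁) P) := by
  -- `A₀ᶜᶜ¹ ≤ A₀ᶜ ≤ 1∕16`, `γ·A₀·log γ⁻² ≤ 1∕10` (12Iᵂ §0), `SmallnessFor γ β' ½ 2 1` (12Iᵂ §2); `r = p₀ = M₂ = 1`, `M = L^{jM}`, `θ.γ = γ` by `rfl`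
  have hA : 0 ≤ A0OfThm1CC1 F.L B₃ B₃' a₀ a₁ := A0OfThm1CC1_nonneg hwB hwB' hwa₀ hwa₁
  have hA' : A0OfThm1CC1 F.L B₃ B₃' a₀ a₁ ≤ 1 / 16 := (A0OfThm1CC1_le hwB hwB' hwa₀ hwa₁).trans (A0OfThm1C_le_sixteenth hwB)
  exact b15Leaf_WOfRecord₁₃_pinAllΛΩχZ_N0_liveRepin₁₃_of_massLive_of_hasResiduals_of_inInterval
    (theta13OfNumerics F N (stage12NumericsOfThm1CCMW F.L jM γ ε₀ B₃ B₃' a₀ a₁) ε₂₉ (zeta316OfRecord F N (stage12NumericsOfThm1CCMW F.L jM γ ε₀ B₃ B₃' a₀ a₁).ν (stage12NumericsOfThm1CCMW F.L jM γ ε₀ B₃ B₃' a₀ a₁).τ9.M (stage12NumericsOfThm1CCMW F.L jM γ ε₀ B₃ B₃' a₀ a₁).A₁) (RzOfRecord F N) (ZtOfRecord F N)) lam σ s Nm p₁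
    (hasResidualsOfRecord_theta13OfNumerics F N (stage12NumericsOfThm1CCMW F.L jM γ ε₀ B₃ B₃' a₀ a₁) ε₂₉) (hM₂ := Nat.one_pos) (hM := pow_pos (Nat.zero_lt_of_lt F.hL.2) jM) (hr := le_rfl)
    (hβhist := betaAlongHistory_nonneg_of_betaLowerH hb (betaLowerH_theta13OfThm1CCMW_of_half hγh hβlo) hI) (hA₀ := hA)
    (S := smallnessFor_half_two_one hγ0 hγe hβ'0 hγβ) (hβ₀ := by norm_num) (hε10 := gamma_mul_p0Profile_le_tenth hγ0 hγh hA hA')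
    (hup := betaUpperH_theta13OfThm1CCMW_of_half hγh hβhi)
    (hK := hK) (hD := hD) (hmassLive := hmassLive) (hP1 := hP1) (hNN := hNN) (hNk := hNk) (hβ0 := hβ0) (hβ := hβ) (hL₀ := hL₀) (hL₀L := hL₀L)
    (hB := hB) (hδ := hδ) (hwin := hwin) (hMl := hMl) (hI := hI) (hΛ := hΛ) (L91h := L91h) (L95 := L95) (L91 := L91) (L97 := L97)
    (L80 := L80)

end Window

end Summit.QuantumFields.YangMills.BalabanUVNodes.N12AtRecord13TermPinnedZresWindow
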